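import Literature.MathematicalPhysics.QuantumFieldTheory.Balaban1983to89.B9Cor35CDirCarrierAtOne
import Literature.MathematicalPhysics.QuantumFieldTheory.Balaban1983to89.B9Eq357CubeQpDiffMajorant

/-!
# `Balaban1983to89.B9Cor35CDirCarrierQLetters` — [Balaban1985BackgroundPropagators] (3.19)∕(3.21) p. 394 AND (3.57)∕(3.59) pp. 401–402 FOR THE CUBE
# AVERAGING LETTERS READ ON THE DIRICHLET CARRIER `𝔖 × ι`: the two-space majorants `hQc ∕ hQcs` and the (3.59) perturbation letters `Fc ∕ Fcs` with their
# majorants `hFc ∕ hFcs` — four more `A`-independent-in-form binders of `B9Thm34InvBlk.thm34_Cinv_uniform_blk` at the Dirichlet third cube letter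
# (r05's `B9Cor36CubeSandwichQ` ∕ `B9Eq357CubeQpDiffMajorant` composed with the local maps `res ∕ ext` of FILE `B9Cor35CDirCarrierAtOne`; ROAD (I) U6b-ii; seat dag-n06-c g33)

statement-level skeleton of published theorems with citation tags; proofs where landed; nothing here is a claim about the Yang–Mills mass gap

## What this file does (mathematically)

The `C`-step of Theorem 3.4 ([Balaban1985BackgroundPropagators] p. 403 (3.65)–(3.67)) on the Dirichlet carrier `P := 𝔖 × ι` (FILE `B9Cor35CDirCarrierAtOne`)
reads the cube averaging operators `Q′_□(V)`, `Q′*_□(V)` through the restriction `res : blocks → 𝔖` and the extension `ext : 𝔖 → blocks`.  In real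
coordinates these are LOCAL two-space letters with majorant `𝟙[a = a′]` (§1), so r06's `hasMajorantHom_local_comp ∕ _comp_local` transport r05's
block-locality of `conjHom b Q′_□(V)` ∕ `conjHom b Q′*_□(V)` (majorant `𝟙[a = a′]·M₂Σ‖b‖`, any contractive transporters) and of the (3.59) differences
`conjHom b (Q′_□(Ṽ) − Q′_□(1))` (majorant `𝟙·M₂Σ‖b‖·τ` from the pointwise (3.59) size `τ`) to the carrier letters `QcR ∕ QcsR` and
`FcR V := QcR V − QcR 1`, `FcsR V := QcsR V − QcsR 1` (§2–§3).

## Status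

Printed-statement pass + proof body (proof-backed; a port in the tree's vocabulary): [Balaban1985BackgroundPropagators] pp. 394, 401–403, 409, re-read
2026-08-31.  Honest label: bookkeeping transports; the (3.59) SIZES `τ = C_q·α₁` themselves remain hypotheses (they are the `A`-dependent data); the engine is
not run here.  Node N06 of the `pub-ymgap` DAG is NOT discharged here and the Yang–Mills mass gap is NOT proved here.  NEW file; nothing landed is
modified.  No `sorry`, no `axiom`, no `instance`, no `notation`.  Net new unproved facts: 0.  Cell `pub-ymgap` (HUMAN RULING D-0062), node N06 [B9], seat
`pub-ymgap-dag-n06-c` (g33), 2026-08-31.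
RELATED, NOT DUPLICATED (searched 2026-08-31: `rg 'conjHom_res_apply|hasMajorantHom_QcR|FcR |FcsR |hasMajorantHom_FcR'` over `Literature ∕ Summits` = ∅): r05
`B9Cor36CubeSandwichQ.hasMajorantHom_conjHom_QpCubeY ∕ QpsCubeY`, `B9Eq357CubeQpDiffMajorant.hasMajorantHom_conjHom_QpCubeY_sub ∕ QpsCubeY_sub` (full block
carrier; USED BY NAME), r06 `B9Ineq349Hom.hasMajorantHom_local_comp ∕ _comp_local` (USED BY NAME).
-/

noncomputable section

namespace Literature.MathematicalPhysics.QuantumFieldTheory.Balaban1983to89.B9Cor35CDirCarrierQLetters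

open B6KLevelCensusIndexV1 (KIdx)
open B6Cover236MultiLevelBlocks (cubes)
open B6RandomWalk (HasMajorant BlockSupp)
open B6RandomWalkHom (HasMajorantHom hasMajorantHom_mono)
open B9Thm34Ext (toB6)
open B9Eq352DivFormLetters (coordEquiv conj coordEquiv_apply coordEquiv_symm_apply)
open B9Eq376POneLetters (conjHom conjHom_apply conjHom_comp conjHom_sub)
open B9Ineq349Hom (hasMajorantHom_local_comp hasMajorantHom_comp_local)
open B9CubeLettersBondOpsL0 (BlkCubeY qpKc qpsKc QpCubeY QpsCubeY)
open B9Eq360DeltaPrimeACubeY (blkCubeY)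
open B9CubeGeometryInputs (geoCK)
open B9Cor36CubeSandwichQ (hasMajorantHom_conjHom_QpCubeY hasMajorantHom_conjHom_QpsCubeY)
open B9Eq357CubeQpDiffMajorant (hasMajorantHom_conjHom_QpCubeY_sub hasMajorantHom_conjHom_QpsCubeY_sub)
open B9Cor35CDirCarrierAtOne (resMatY extMatY SBlk QcR QcsR)
open Node00 (SiteY CfgY toKT liftMatY liftMatY_apply)
open Node00.OpsYCubeKnitPar (parKnitCubeY)
open scoped Matrix

variable {d ℓ : ℕ} {hd : 1 ≤ d + 1} {hL : Odd (ℓ + 1) ∧ 1 < ℓ + 1} {b₀ b₁ : ℝ}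
variable {𝔸 : Type} [NormedRing 𝔸] [NormedAlgebra ℂ 𝔸] [CompleteSpace 𝔸]
variable {ι : Type} [Fintype ι] (b : Module.Basis ι ℝ 𝔸)
variable (i : KIdx d ℓ hd hL b₀ b₁) (c : ↥(cubes (toKT i).D.toDomains))
variable {Rr : ℝ} {Hp : Prop}

/-! ## §1 `res♯` and `ext♯` in real coordinates: local two-space letters with majorant `𝟙[a = a′]` -/

omit [CompleteSpace 𝔸] in
/-- `b.repr ((coord⁻¹ν)(x)) j = ν(x, j)`. [cite: Balaban1984PropagatorsII, (2.51) p.232, bookkeeping] -/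
theorem repr_coordSymm_apply {X : Type} (ν : X × ι → ℝ) (x : X) (j : ι) : b.repr ((coordEquiv b).symm ν x) j = ν (x, j) := by
  rw [← coordEquiv_apply b ((coordEquiv b).symm ν) (x, j), LinearEquiv.apply_symm_apply]

omit [CompleteSpace 𝔸] in
/-- `res♯` in coordinates: `(res♯ν)(v, j) = ν(v, j)`. [cite: Balaban1985BackgroundPropagators, p.394, bookkeeping] -/
theorem conjHom_res_apply {X : Type} [Fintype X] [DecidableEq X] (𝔖 : Finset X) (ν : X × ι → ℝ) (p : ↥𝔖 × ι) :
    conjHom b ((liftMatY 𝔸 (resMatY 𝔖)).restrictScalars ℝ) ν p = ν ((p.1 : X), p.2) := by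
  rw [conjHom_apply, LinearMap.restrictScalars_apply, liftMatY_apply]
  have hs : ∑ x, ((resMatY 𝔖 p.1 x : ℝ) : ℂ) • (coordEquiv b).symm ν x = (coordEquiv b).symm ν (p.1 : X) := by
    simp only [resMatY, apply_ite Complex.ofReal, Complex.ofReal_one, Complex.ofReal_zero, ite_smul, one_smul, zero_smul, Finset.sum_ite_eq,
      Finset.mem_univ, if_true]
  rw [hs, repr_coordSymm_apply]

omit [CompleteSpace 𝔸] in
/-- `ext♯` in coordinates: `(ext♯ν)(x, j) = ν(x, j)` on `𝔖`, `0` off `𝔖`. [cite: Balaban1985BackgroundPropagators, p.394, bookkeeping] -/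
theorem conjHom_ext_apply {X : Type} [Fintype X] [DecidableEq X] (𝔖 : Finset X) (ν : ↥𝔖 × ι → ℝ) (q : X × ι) :
    conjHom b ((liftMatY 𝔸 (extMatY 𝔖)).restrictScalars ℝ) ν q = if h : q.1 ∈ 𝔖 then ν (⟨q.1, h⟩, q.2) else 0 := by
  rw [conjHom_apply, LinearMap.restrictScalars_apply, liftMatY_apply]
  by_cases hq : q.1 ∈ 𝔖
  · rw [dif_pos hq, Finset.sum_eq_single (⟨q.1, hq⟩ : ↥𝔖)]
    · simp only [extMatY, if_true, Complex.ofReal_one, one_smul]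
      exact repr_coordSymm_apply b ν ⟨q.1, hq⟩ q.2
    · intro v _ hv
      have : q.1 ≠ (v : X) := fun h => hv (Subtype.ext h.symm)
      simp only [extMatY, if_neg this, Complex.ofReal_zero, zero_smul]
    · intro h; exact absurd (Finset.mem_univ _) h
  · rw [dif_neg hq, Finset.sum_eq_zero (fun v _ => ?_), map_zero, Finsupp.zero_apply]
    have : q.1 ≠ (v : X) := fun h => hq (h ▸ v.2)
    simp only [extMatY, if_neg this, Complex.ofReal_zero, zero_smul]

omit [CompleteSpace 𝔸] in
/-- ★ `res♯` IS LOCAL: two-space majorant `𝟙[a = a′]` from the block carrier to the sub-carrier. [cite: Balaban1984PropagatorsII, (2.51) p.232; Balaban1985BackgroundPropagators, p.394] -/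
theorem hasMajorantHom_res (𝔖 : Finset (BlkCubeY i c)) :
    HasMajorantHom (g := toB6 (geoCK i c) Rr Hp) (fun q : BlkCubeY i c × ι => q.1) (fun p : ↥𝔖 × ι => (p.1 : BlkCubeY i c))
      (conjHom b ((liftMatY 𝔸 (resMatY 𝔖)).restrictScalars ℝ)) (fun a a' : BlkCubeY i c => if a = a' then (1 : ℝ) else 0) := by
  intro y' μ B hμ p
  rw [conjHom_res_apply]
  dsimp only
  by_cases h : (p.1 : BlkCubeY i c) = y'
  · rw [if_pos h, one_mul]; exact hμ.bound ((p.1 : BlkCubeY i c), p.2) h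
  · rw [hμ.off ((p.1 : BlkCubeY i c), p.2) h, abs_zero, if_neg h, zero_mul]

omit [CompleteSpace 𝔸] in
/-- ★ `ext♯` IS LOCAL: two-space majorant `𝟙[a = a′]` from the sub-carrier to the block carrier. [cite: Balaban1984PropagatorsII, (2.51) p.232; Balaban1985BackgroundPropagators, p.394] -/
theorem hasMajorantHom_ext (𝔖 : Finset (BlkCubeY i c)) :
    HasMajorantHom (g := toB6 (geoCK i c) Rr Hp) (fun p : ↥𝔖 × ι => (p.1 : BlkCubeY i c)) (fun q : BlkCubeY i c × ι => q.1)
      (conjHom b ((liftMatY 𝔸 (extMatY 𝔖)).restrictScalars ℝ)) (fun a a' : BlkCubeY i c => if a = a' then (1 : ℝ) else 0) := by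
  intro y' μ B hμ q
  rw [conjHom_ext_apply]
  dsimp only
  by_cases hq : q.1 ∈ 𝔖
  · rw [dif_pos hq]
    by_cases h : q.1 = y'
    · rw [if_pos h, one_mul]; exact hμ.bound (⟨q.1, hq⟩, q.2) h
    · rw [hμ.off (⟨q.1, hq⟩, q.2) h, abs_zero, if_neg h, zero_mul]
  · rw [dif_neg hq, abs_zero]
    split_ifs
    · rw [one_mul]; exact hμ.nonneg
    · rw [zero_mul]

/-! ## §2 The (3.19)∕(3.21) majorants `hQc`, `hQcs` on the carrier -/

/-- `QcR V = res♯ ∘ conjHom b Q′_□(V)`. [cite: Balaban1985BackgroundPropagators, (3.21) p.394, bookkeeping] -/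
theorem QcR_eq_comp (V : CfgY 𝔸 i) :
    QcR b i c V = conjHom b ((liftMatY 𝔸 (resMatY (SBlk i c))).restrictScalars ℝ) ∘ₗ conjHom b ((QpCubeY i c (parKnitCubeY i c) V).restrictScalars ℝ) := by
  rw [QcR, conjHom_comp]

/-- `QcsR V = conjHom b Q′*_□(V) ∘ ext♯`. [cite: Balaban1985BackgroundPropagators, (3.21) p.394, bookkeeping] -/
theorem QcsR_eq_comp (V : CfgY 𝔸 i) :
    QcsR b i c V = conjHom b ((QpsCubeY i c (parKnitCubeY i c) V).restrictScalars ℝ) ∘ₗ conjHom b ((liftMatY 𝔸 (extMatY (SBlk i c))).restrictScalars ℝ) := by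
  rw [QcsR, conjHom_comp]

/-- ★★ **BINDER `hQc` ON THE CARRIER**: `QcR V ≺ 𝟙[a = a′]·M₂Σ_j‖b_j‖` from the site carrier (`(z, j) ↦ blkCubeY z`) to `𝔖 × ι` (`(s, j) ↦ s`), for every field whose
knit cube legs are contractive. [cite: Balaban1985BackgroundPropagators, (3.19)–(3.21) p.394, (3.57) p.401, Thm 3.4 p.400; Balaban1984PropagatorsII, (2.51) p.232] -/
theorem hasMajorantHom_QcR (V : CfgY 𝔸 i)
    (hpar : ∀ z w : SiteY i, ‖(parKnitCubeY i c V z w : 𝔸)‖ ≤ 1 ∧ ‖(((parKnitCubeY i c V z w)⁻¹ : 𝔸ˣ) : 𝔸)‖ ≤ 1)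
    {M₂ : ℝ} (hM₂ : 0 ≤ M₂) (hrepr : ∀ (v : 𝔸) (j : ι), |b.repr v j| ≤ M₂ * ‖v‖) :
    HasMajorantHom (g := toB6 (geoCK i c) Rr Hp) (fun p : SiteY i × ι => blkCubeY i c p.1) (fun q : ↥(SBlk i c) × ι => (q.1 : BlkCubeY i c))
      (QcR b i c V) (fun a a' : BlkCubeY i c => if a = a' then M₂ * ∑ j, ‖b j‖ else 0) := by
  classical
  have hK : ∀ a a' : BlkCubeY i c, 0 ≤ (if a = a' then M₂ * ∑ j, ‖b j‖ else 0) := fun a a' => by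
    split_ifs
    · exact mul_nonneg hM₂ (Finset.sum_nonneg fun j _ => norm_nonneg _)
    · exact le_rfl
  rw [QcR_eq_comp]
  refine hasMajorantHom_mono (g := toB6 (geoCK i c) Rr Hp) _ _
    (hasMajorantHom_local_comp (g := geoCK i c) (R := Rr) (H := Hp) _ _ _ 1 hK (hasMajorantHom_res b i c (SBlk i c))
      (hasMajorantHom_conjHom_QpCubeY i c b (parKnitCubeY i c) V (Rr := Rr) (Hp := Hp) hpar hM₂ hrepr)) fun a a' => by rw [one_mul]

/-- ★★ **BINDER `hQcs` ON THE CARRIER**: `QcsR V ≺ 𝟙[a = a′]·M₂Σ_j‖b_j‖` from `𝔖 × ι` to the site carrier. [cite: Balaban1985BackgroundPropagators, (3.19)–(3.21) p.394, (3.57) p.401, Thm 3.4 p.400; Balaban1984PropagatorsII, (2.51) p.232] -/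
theorem hasMajorantHom_QcsR (V : CfgY 𝔸 i)
    (hpar : ∀ z w : SiteY i, ‖(parKnitCubeY i c V z w : 𝔸)‖ ≤ 1 ∧ ‖(((parKnitCubeY i c V z w)⁻¹ : 𝔸ˣ) : 𝔸)‖ ≤ 1)
    {M₂ : ℝ} (hM₂ : 0 ≤ M₂) (hrepr : ∀ (v : 𝔸) (j : ι), |b.repr v j| ≤ M₂ * ‖v‖) :
    HasMajorantHom (g := toB6 (geoCK i c) Rr Hp) (fun q : ↥(SBlk i c) × ι => (q.1 : BlkCubeY i c)) (fun p : SiteY i × ι => blkCubeY i c p.1)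
      (QcsR b i c V) (fun a a' : BlkCubeY i c => if a = a' then M₂ * ∑ j, ‖b j‖ else 0) := by
  classical
  rw [QcsR_eq_comp]
  refine hasMajorantHom_mono (g := toB6 (geoCK i c) Rr Hp) _ _
    (hasMajorantHom_comp_local (g := geoCK i c) (R := Rr) (H := Hp) _ _ _ 1 zero_le_one
      (hasMajorantHom_conjHom_QpsCubeY i c b (parKnitCubeY i c) V (Rr := Rr) (Hp := Hp) hpar hM₂ hrepr) (hasMajorantHom_ext b i c (SBlk i c)))
    fun a a' => by rw [mul_one]

/-! ## §3 The (3.59) letters `Fc`, `Fcs` on the carrier and their majorants `hFc`, `hFcs` -/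

/-- **`FcR V := QcR V − QcR 1`** (print's `Q′(U′U) − Q′(U)` read on the carrier). [cite: Balaban1985BackgroundPropagators, (3.57) p.401, (3.59) p.402] -/
def FcR (V : CfgY 𝔸 i) : (SiteY i × ι → ℝ) →ₗ[ℝ] (↥(SBlk i c) × ι → ℝ) := QcR b i c V - QcR b i c (fun _ _ => 1)

/-- **`FcsR V := QcsR V − QcsR 1`**. [cite: Balaban1985BackgroundPropagators, (3.57) p.401, (3.59) p.402] -/
def FcsR (V : CfgY 𝔸 i) : (↥(SBlk i c) × ι → ℝ) →ₗ[ℝ] (SiteY i × ι → ℝ) := QcsR b i c V - QcsR b i c (fun _ _ => 1)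

/-- the engine's clause `Qc′ = Qc + Fc`. [cite: Balaban1985BackgroundPropagators, (3.57) p.401, bookkeeping] -/
theorem QcR_eq_add (V : CfgY 𝔸 i) : QcR b i c V = QcR b i c (fun _ _ => 1) + FcR b i c V := by
  rw [FcR, add_sub_cancel]

/-- the engine's clause `Qcs′ = Qcs + Fcs`. [cite: Balaban1985BackgroundPropagators, (3.57) p.401, bookkeeping] -/
theorem QcsR_eq_add (V : CfgY 𝔸 i) : QcsR b i c V = QcsR b i c (fun _ _ => 1) + FcsR b i c V := by
  rw [FcsR, add_sub_cancel]

/-- `FcR V = res♯ ∘ conjHom b (Q′_□(V) − Q′_□(1))`. [cite: Balaban1985BackgroundPropagators, (3.57) p.401, bookkeeping] -/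
theorem FcR_eq_comp (V : CfgY 𝔸 i) :
    FcR b i c V = conjHom b ((liftMatY 𝔸 (resMatY (SBlk i c))).restrictScalars ℝ) ∘ₗ
      conjHom b ((QpCubeY i c (parKnitCubeY i c) V - QpCubeY i c (parKnitCubeY i c) (fun _ _ => 1)).restrictScalars ℝ) := by
  rw [FcR, QcR_eq_comp, QcR_eq_comp, ← LinearMap.comp_sub, ← conjHom_sub]
  rfl

/-- `FcsR V = conjHom b (Q′*_□(V) − Q′*_□(1)) ∘ ext♯`. [cite: Balaban1985BackgroundPropagators, (3.57) p.401, bookkeeping] -/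
theorem FcsR_eq_comp (V : CfgY 𝔸 i) :
    FcsR b i c V = conjHom b ((QpsCubeY i c (parKnitCubeY i c) V - QpsCubeY i c (parKnitCubeY i c) (fun _ _ => 1)).restrictScalars ℝ) ∘ₗ
      conjHom b ((liftMatY 𝔸 (extMatY (SBlk i c))).restrictScalars ℝ) := by
  rw [FcsR, QcsR_eq_comp, QcsR_eq_comp, ← LinearMap.sub_comp, ← conjHom_sub]
  rfl

/-- ★★ **BINDER `hFc` ON THE CARRIER**: a pointwise (3.59) size `‖(Q′_□(Ṽ) − Q′_□(1))λ(s)‖ ≤ τ·Σ_z|q′_□(s,z)|‖λ(z)‖` (`τ ≥ 0`) gives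
`FcR Ṽ ≺ 𝟙[a = a′]·M₂Σ‖b‖·τ`. [cite: Balaban1985BackgroundPropagators, (3.57) p.401, (3.59) p.402, Thm 3.4 p.400; Balaban1984PropagatorsII, (2.51) p.232] -/
theorem hasMajorantHom_FcR (V : CfgY 𝔸 i) {M₂ : ℝ} (hM₂ : 0 ≤ M₂) (hrepr : ∀ (v : 𝔸) (j : ι), |b.repr v j| ≤ M₂ * ‖v‖) {τ : ℝ} (hτ : 0 ≤ τ)
    (hF : ∀ (s : BlkCubeY i c) (lam : SiteY i → 𝔸),
      ‖(QpCubeY i c (parKnitCubeY i c) V lam - QpCubeY i c (parKnitCubeY i c) (fun _ _ => 1) lam) s‖ ≤ τ * ∑ z, |qpKc i c s z| * ‖lam z‖) :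
    HasMajorantHom (g := toB6 (geoCK i c) Rr Hp) (fun p : SiteY i × ι => blkCubeY i c p.1) (fun q : ↥(SBlk i c) × ι => (q.1 : BlkCubeY i c))
      (FcR b i c V) (fun a a' : BlkCubeY i c => if a = a' then M₂ * (∑ j, ‖b j‖) * τ else 0) := by
  classical
  have hK : ∀ a a' : BlkCubeY i c, 0 ≤ (if a = a' then M₂ * (∑ j, ‖b j‖) * τ else 0) := fun a a' => by
    split_ifs
    · exact mul_nonneg (mul_nonneg hM₂ (Finset.sum_nonneg fun j _ => norm_nonneg _)) hτ
    · exact le_rfl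
  rw [FcR_eq_comp]
  refine hasMajorantHom_mono (g := toB6 (geoCK i c) Rr Hp) _ _
    (hasMajorantHom_local_comp (g := geoCK i c) (R := Rr) (H := Hp) _ _ _ 1 hK (hasMajorantHom_res b i c (SBlk i c))
      (hasMajorantHom_conjHom_QpCubeY_sub i c b (parKnitCubeY i c) V (fun _ _ => 1) (Rr := Rr) (Hp := Hp) hM₂ hrepr hτ hF)) fun a a' => by rw [one_mul]

/-- ★★ **BINDER `hFcs` ON THE CARRIER**: the pointwise (3.59) size of `Q′*_□(Ṽ) − Q′*_□(1)` gives `FcsR Ṽ ≺ 𝟙[a = a′]·M₂Σ‖b‖·τ`.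
[cite: Balaban1985BackgroundPropagators, (3.57) p.401, (3.59) p.402, Thm 3.4 p.400; Balaban1984PropagatorsII, (2.51) p.232] -/
theorem hasMajorantHom_FcsR (V : CfgY 𝔸 i) {M₂ : ℝ} (hM₂ : 0 ≤ M₂) (hrepr : ∀ (v : 𝔸) (j : ι), |b.repr v j| ≤ M₂ * ‖v‖) {τ : ℝ} (hτ : 0 ≤ τ)
    (hFs : ∀ (z : SiteY i) (nu : BlkCubeY i c → 𝔸),
      ‖(QpsCubeY i c (parKnitCubeY i c) V nu - QpsCubeY i c (parKnitCubeY i c) (fun _ _ => 1) nu) z‖ ≤ τ * ∑ s, |qpsKc i c z s| * ‖nu s‖) :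
    HasMajorantHom (g := toB6 (geoCK i c) Rr Hp) (fun q : ↥(SBlk i c) × ι => (q.1 : BlkCubeY i c)) (fun p : SiteY i × ι => blkCubeY i c p.1)
      (FcsR b i c V) (fun a a' : BlkCubeY i c => if a = a' then M₂ * (∑ j, ‖b j‖) * τ else 0) := by
  classical
  rw [FcsR_eq_comp]
  refine hasMajorantHom_mono (g := toB6 (geoCK i c) Rr Hp) _ _
    (hasMajorantHom_comp_local (g := geoCK i c) (R := Rr) (H := Hp) _ _ _ 1 zero_le_one
      (hasMajorantHom_conjHom_QpsCubeY_sub i c b (parKnitCubeY i c) V (fun _ _ => 1) (Rr := Rr) (Hp := Hp) hM₂ hrepr hτ hFs)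
      (hasMajorantHom_ext b i c (SBlk i c))) fun a a' => by rw [mul_one]

end Literature.MathematicalPhysics.QuantumFieldTheory.Balaban1983to89.B9Cor35CDirCarrierQLetters
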